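import Summits.Schanuel.Schanuel.Theorems.ZilberEacRealLineTiltedZeros
import Summits.Schanuel.Schanuel.Theorems.ZilberEacRealLineSurfaceDensity
import Summits.Schanuel.Schanuel.Theorems.ZilberEacPowerGrowthElimination
import HarnessLib

/-!
# Non-split surfaces over a line of REAL IRRATIONAL slope, V: EVERY fibre polynomial

HONEST FRAMING.  Cell `pub-schanuel` (Zilber's Exponential-Algebraic Closedness, case ladder;
host summit Schanuel), seat 2, gen 18 (HANDOFF O68 (a)).  **`unprojectedDense_lineSurface_of_irrational_all`**:
`a ∈ ℝ ∖ ℚ`, `b ∈ ℂ`, `P ∈ ℂ[x; y₀, y₁]` irreducible with two monomials of different `(y₀, y₁)`-exponent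
⟹ the exponential points of `{x₁ = ax₀ + b, P(x₀; y₀, y₁) = 0} ⊆ ℂ² × ℂ²` are Zariski dense.  With
torus fibres over infinitely many base points the two-exponent hypothesis is automatic and the
surface is in Mantova–Masser's case: **`unprojectedDensityQuestion_lineSurface_of_irrational_all`**
(case ∧ dense) — together with gen 17 (`unprojectedDense_lineSurface_of_im_ne_zero`, non-real
slopes) Mantova–Masser's density question now holds for EVERY surface of their case (dim-π-S-1-free)
lying over a LINE (the closure of the base is then a line of non-rational slope: either non-real,
or real irrational).  Proof: an upper supporting line `d₀ + μ(d₁ + a d₂) ≤ κ` of `supp P` through two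
monomials; if `μ = 0` the top `x`-row has two monomials, hence a torus zero, and
`unprojectedDense_lineSurface_of_irrational` applies (accumulation + diagonal lemma); if `μ ≠ 0` the
zeros of `P(z; e^z, e^{az+b})` in the TILTED windows (`exists_zero_at_far_tilted_window`) have
`log|y₀| = μ log|x₀| + O(1)`, `log|y₁| = aμ log|x₀| + O(1)`, and THEOREM I⁽ᵏ⁾
(`unprojectedDense_of_powerGrowth_family`, gen 15) eliminates every algebraic relation: the weights
`(1, μ)` (`μ ∉ ℚ`) resp. `(1, aμ)` (`μ ∈ ℚ ∖ {0}`) are injective on `ℕ²`.  Example: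
`{x₁ = √2x₀, y₁ = x₀y₀}` (monomial top row `x₀y₀`; `e^{√2z} = ze^z`).  NOT Schanuel's conjecture
(neither used nor implied; EAC ⇏ SC); `EC(3,2)` stays OPEN; classes of instances of an OPEN question
(PLMS 2024, §1 p. 5); rational slopes, non-graph base curves, Fib(3,2) stay open.
-/

noncomputable section

open Filter Topology Metric Set Complex MvPolynomial
open Literature.NumberTheory.Transcendental Literature.ModelTheory.Zilber
open Literature.ModelTheory.ExponentialFields

set_option linter.dupNamespace false

namespace Summit.Schanuel.Schanuel.Theorems

/-! ## Part A. Density along a tilted edge (`μ ≠ 0`): power-growth elimination -/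

section Tilted

variable {a : ℝ} (b : ℂ) {P : MvPolynomial (Fin 3) ℂ}

/-- **Density along a tilted edge.**  `a ∈ ℝ ∖ ℚ`, `P` irreducible, an upper supporting line with
`μ ≠ 0` and a unimodular zero of the (not identically vanishing) edge family ⟹
`{x₁ = ax₀ + b, P = 0}` has Zariski-dense exponential points. (new) -/
theorem unprojectedDense_lineSurface_of_tilted_edge (ha : Irrational a) (hirr : Irreducible P)
    (μ κ : ℝ) (hμ : μ ≠ 0)
    (hκ : ∀ d ∈ P.support, ((d 0 : ℕ) : ℝ) + μ * ((d 1 : ℕ) + a * (d 2 : ℕ)) ≤ κ)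
    {u₀ x₀ : ℂ} (hu₀ : ‖u₀‖ = 1)
    (hne : ∃ z, curveFn a b (∑ d ∈ P.support.filter
        (fun d : Fin 3 →₀ ℕ => ((d 0 : ℕ) : ℝ) + μ * ((d 1 : ℕ) + a * (d 2 : ℕ)) = κ),
        monomial (Finsupp.tail d) (P.coeff d * I ^ (d 0))) u₀ z ≠ 0)
    (hx₀ : curveFn a b (∑ d ∈ P.support.filter
        (fun d : Fin 3 →₀ ℕ => ((d 0 : ℕ) : ℝ) + μ * ((d 1 : ℕ) + a * (d 2 : ℕ)) = κ),
        monomial (Finsupp.tail d) (P.coeff d * I ^ (d 0))) u₀ x₀ = 0) :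
    UnprojectedDense {w : Fin 2 ⊕ Fin 2 → ℂ | w (Sum.inl 1) = (linePoly a b).eval (w (Sum.inl 0)) ∧
      MvPolynomial.eval ![w (Sum.inl 0), w (Sum.inr 0), w (Sum.inr 1)] P = 0} := by
  obtain ⟨z, T, hT, hz0, hzinf, hzlog, hzre⟩ :=
    exists_lineSurface_tilted_zeros b P ha μ κ hκ hu₀ hne hx₀
  have hS := isIrreducibleClosed_graphSurface (linePoly a b) hirr
  have hdim := zariskiDim_graphSurface (linePoly a b) hirr
  -- the exponential points
  set p : ℕ → Fin 2 ⊕ Fin 2 → ℂ := fun k => rfLinePt a b (z k) with hp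
  have hpS : ∀ k, p k ∈ {w : Fin 2 ⊕ Fin 2 → ℂ | w (Sum.inl 1) = (linePoly a b).eval (w (Sum.inl 0)) ∧
      MvPolynomial.eval ![w (Sum.inl 0), w (Sum.inr 0), w (Sum.inr 1)] P = 0} := by
    intro k
    refine ⟨by simp [hp], ?_⟩
    have e : (![rfLinePt a b (z k) (Sum.inl 0), rfLinePt a b (z k) (Sum.inr 0),
        rfLinePt a b (z k) (Sum.inr 1)] : Fin 3 → ℂ) = Fin.cons (z k) (rfPt a b 1 (z k)) := by
      funext j
      refine Fin.cases ?_ (fun j' => ?_) j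
      · simp
      · fin_cases j' <;> simp [rfPt]
    simp only [hp]
    rw [e]
    exact hz0 k
  have hpΓ : ∀ k, p k ∈ expGraph ℂ 2 := fun k => rfLinePt_mem_expGraph a b _
  have hmem : ∀ᶠ k in atTop, p k ∈ {w : Fin 2 ⊕ Fin 2 → ℂ |
      w (Sum.inl 1) = (linePoly a b).eval (w (Sum.inl 0)) ∧
      MvPolynomial.eval ![w (Sum.inl 0), w (Sum.inr 0), w (Sum.inr 1)] P = 0} ∧ p k ∈ expGraph ℂ 2 :=
    Filter.Eventually.of_forall fun k => ⟨hpS k, hpΓ k⟩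
  -- the three coordinates and their growth
  have hx : ∀ᶠ k in atTop, p k (Sum.inl 0) ≠ 0 ∧ |Real.log ‖p k (Sum.inl 0)‖ - 1 * T k| ≤
      |a| * (‖x₀‖ + 1) + ‖b‖ + ‖x₀‖ + 2 := by
    filter_upwards [hzlog, hzinf.eventually_ge_atTop 1] with k hk hk1
    refine ⟨?_, ?_⟩
    · have : ‖p k (Sum.inl 0)‖ ≠ 0 := by simp only [hp, rfLinePt_inl_zero]; linarith
      exact fun h => this (by rw [h, norm_zero])
    · simp only [hp, rfLinePt_inl_zero, one_mul]
      have : 0 ≤ |a| * (‖x₀‖ + 1) + ‖b‖ + ‖x₀‖ := by positivity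
      linarith
  have hy₀ : ∀ k, p k (Sum.inr 0) ≠ 0 ∧ |Real.log ‖p k (Sum.inr 0)‖ - μ * T k| ≤
      |a| * (‖x₀‖ + 1) + ‖b‖ + ‖x₀‖ + 2 := by
    intro k
    simp only [hp, rfLinePt_inr, rfPt_zero]
    refine ⟨Complex.exp_ne_zero _, ?_⟩
    rw [Complex.norm_exp, Real.log_exp]
    have : 0 ≤ |a| * (‖x₀‖ + 1) + ‖b‖ := by positivity
    linarith [hzre k]
  have hy₁ : ∀ k, p k (Sum.inr 1) ≠ 0 ∧ |Real.log ‖p k (Sum.inr 1)‖ - a * μ * T k| ≤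
      |a| * (‖x₀‖ + 1) + ‖b‖ + ‖x₀‖ + 2 := by
    intro k
    simp only [hp, rfLinePt_inr, rfPt_one, one_mul]
    refine ⟨Complex.exp_ne_zero _, ?_⟩
    rw [Complex.norm_exp, Real.log_exp, rf_re_line]
    have h1 : |a * (z k).re - a * μ * T k| ≤ |a| * (‖x₀‖ + 1) := by
      rw [show a * (z k).re - a * μ * T k = a * ((z k).re - μ * T k) by ring, abs_mul]
      exact mul_le_mul_of_nonneg_left (hzre k) (abs_nonneg a)
    have h2 : |b.re| ≤ ‖b‖ := Complex.abs_re_le_norm b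
    have h3 := abs_add_le (a * (z k).re - a * μ * T k) b.re
    rw [show a * (z k).re - a * μ * T k + b.re = a * (z k).re + b.re - a * μ * T k by ring] at h3
    have : 0 ≤ ‖x₀‖ := norm_nonneg _
    linarith
  -- elimination
  by_cases hμirr : Irrational μ
  · refine unprojectedDense_of_powerGrowth_family hS (k := 1) (by rw [hdim])
      ![Sum.inl 0, Sum.inr 0] fun H hH => ⟨![1, μ], injOn_weight_of_irrational hμirr _, p, T,
        |a| * (‖x₀‖ + 1) + ‖b‖ + ‖x₀‖ + 2, hT, hmem, fun i => ?_⟩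
    fin_cases i
    · simpa using hx
    · exact Filter.Eventually.of_forall fun k => by simpa using hy₀ k
  · -- `μ ∈ ℚ ∖ {0}`: use `y₁` with exponent `aμ ∉ ℚ`
    have hq : ∃ q : ℚ, (q : ℝ) = μ := by
      unfold Irrational at hμirr; push Not at hμirr; exact hμirr
    obtain ⟨q, hq⟩ := hq
    have hq0 : q ≠ 0 := by rintro rfl; exact hμ (by rw [← hq]; simp)
    have haμ : Irrational (a * μ) := by rw [← hq]; exact ha.mul_ratCast hq0
    refine unprojectedDense_of_powerGrowth_family hS (k := 1) (by rw [hdim])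
      ![Sum.inl 0, Sum.inr 1] fun H hH => ⟨![1, a * μ], injOn_weight_of_irrational haμ _, p, T,
        |a| * (‖x₀‖ + 1) + ‖b‖ + ‖x₀‖ + 2, hT, hmem, fun i => ?_⟩
    fin_cases i
    · simpa using hx
    · exact Filter.Eventually.of_forall fun k => by simpa using hy₁ k

end Tilted

/-! ## Part B. Every fibre polynomial -/

section All

variable {a : ℝ} (b : ℂ) {P : MvPolynomial (Fin 3) ℂ}

/-- **EVERY non-split surface over a line of real irrational slope.**  `a ∈ ℝ ∖ ℚ`, `P` irreducible
with two monomials of different `(y₀, y₁)`-exponent ⟹ `{x₁ = ax₀ + b, P(x₀; y₀, y₁) = 0}` has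
Zariski-dense exponential points.
[cite: MantovaMasser2023, §1 Further remarks, p. 5 (the question, open in general)] (new) -/
theorem unprojectedDense_lineSurface_of_irrational_all (ha : Irrational a) (hirr : Irreducible P)
    (h2 : ∃ d ∈ P.support, ∃ d' ∈ P.support, Finsupp.tail d ≠ Finsupp.tail d') :
    UnprojectedDense {w : Fin 2 ⊕ Fin 2 → ℂ | w (Sum.inl 1) = (linePoly a b).eval (w (Sum.inl 0)) ∧
      MvPolynomial.eval ![w (Sum.inl 0), w (Sum.inr 0), w (Sum.inr 1)] P = 0} := by
  classical
  set wt : (Fin 3 →₀ ℕ) → ℝ := fun d => ((d 1 : ℕ) : ℝ) + a * (d 2 : ℕ) with hwt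
  have h2' : ∃ d ∈ P.support, ∃ d' ∈ P.support, wt d ≠ wt d' := by
    obtain ⟨d, hd, d', hd', hne⟩ := h2
    exact ⟨d, hd, d', hd', weight_ne_of_tail_ne ha hne⟩
  obtain ⟨μ, κ, hκ, da, hda, dc, hdc, hwne, hja, hjc⟩ :=
    exists_upper_edge_real P.support wt (fun d => d 0) h2'
  have htne : Finsupp.tail da ≠ Finsupp.tail dc := by
    intro h; apply hwne
    simp only [hwt]
    have h1 : da 1 = dc 1 := by simpa [Finsupp.tail_apply] using DFunLike.congr_fun h 0
    have h2 : da 2 = dc 2 := by simpa [Finsupp.tail_apply] using DFunLike.congr_fun h 1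
    rw [h1, h2]
  by_cases hμ : μ = 0
  · -- two monomials of maximal `x`-degree: the top `x`-row has a torus zero
    have htop : ∀ d ∈ P.support, d 0 ≤ da 0 := by
      intro d hd
      have h1 := hκ d hd
      rw [hμ, zero_mul, add_zero] at h1 hja
      rw [← hja] at h1
      exact_mod_cast h1
    have hdc0 : dc 0 = da 0 := by
      rw [hμ, zero_mul, add_zero] at hja hjc
      have : ((dc 0 : ℕ) : ℝ) = da 0 := by rw [hjc, hja]
      exact_mod_cast this
    set Q := MvPolynomial.finSuccEquiv ℂ 2 P with hQ
    have hdeg : Q.natDegree = da 0 := by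
      rw [hQ, MvPolynomial.natDegree_finSuccEquiv]
      exact le_antisymm (MvPolynomial.degreeOf_le_iff.2 htop) (MvPolynomial.monomial_le_degreeOf 0 hda)
    have hmem : ∀ d ∈ P.support, d 0 = da 0 → Finsupp.tail d ∈ Q.leadingCoeff.support := by
      intro d hd hd0
      rw [MvPolynomial.mem_support_iff, Polynomial.leadingCoeff, hdeg, ← hd0, hQ,
        MvPolynomial.finSuccEquiv_coeff_coeff, Finsupp.cons_tail]
      exact MvPolynomial.mem_support_iff.1 hd
    obtain ⟨c, hc0, hc1, hc⟩ := exists_torus_zero_of_ne (R := Q.leadingCoeff)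
      ⟨_, hmem da hda rfl, _, hmem dc hdc hdc0, htne⟩
    exact unprojectedDense_lineSurface_of_irrational b ha hirr ⟨c, hc0, hc1, hc⟩
  · -- a tilted edge: the edge polynomial has two monomials, hence a unimodular zero
    set Edge := P.support.filter (fun d : Fin 3 →₀ ℕ => ((d 0 : ℕ) : ℝ) + μ * ((d 1 : ℕ) + a * (d 2 : ℕ)) = κ)
      with hEdge
    set RE : MvPolynomial (Fin 2) ℂ := ∑ d ∈ Edge, monomial (Finsupp.tail d) (P.coeff d * I ^ (d 0))
      with hRE
    have hdaE : da ∈ Edge := Finset.mem_filter.2 ⟨hda, hja⟩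
    have hdcE : dc ∈ Edge := Finset.mem_filter.2 ⟨hdc, hjc⟩
    -- tails are injective on the edge
    have hinj : ∀ d ∈ Edge, ∀ d' ∈ Edge, Finsupp.tail d = Finsupp.tail d' → d = d' := by
      intro d hd d' hd' ht
      obtain ⟨-, he⟩ := Finset.mem_filter.1 hd
      obtain ⟨-, he'⟩ := Finset.mem_filter.1 hd'
      have h1 : d 1 = d' 1 := by simpa [Finsupp.tail_apply] using DFunLike.congr_fun ht 0
      have h2 : d 2 = d' 2 := by simpa [Finsupp.tail_apply] using DFunLike.congr_fun ht 1
      have h0 : d 0 = d' 0 := by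
        rw [h1, h2] at he
        have : ((d 0 : ℕ) : ℝ) = d' 0 := by linarith
        exact_mod_cast this
      ext i; fin_cases i; exacts [h0, h1, h2]
    have hcoeff : ∀ d ∈ Edge, RE.coeff (Finsupp.tail d) = P.coeff d * I ^ (d 0) := by
      intro d hd
      rw [hRE, MvPolynomial.coeff_sum, Finset.sum_eq_single d]
      · rw [MvPolynomial.coeff_monomial, if_pos rfl]
      · intro d' hd' hne
        rw [MvPolynomial.coeff_monomial, if_neg]
        exact fun h => hne (hinj d' hd' d hd h)
      · intro h; exact (h hd).elim
    have hsupp : ∀ d ∈ Edge, Finsupp.tail d ∈ RE.support := by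
      intro d hd
      rw [MvPolynomial.mem_support_iff, hcoeff d hd]
      exact mul_ne_zero (MvPolynomial.mem_support_iff.1 (Finset.mem_filter.1 hd).1)
        (pow_ne_zero _ Complex.I_ne_zero)
    have hRE0 : RE ≠ 0 := fun h => by
      have := hsupp da hdaE; rw [h, MvPolynomial.support_zero] at this; simp at this
    obtain ⟨c, hc0, hc1, hc⟩ := exists_torus_zero_of_ne (R := RE)
      ⟨_, hsupp da hdaE, _, hsupp dc hdcE, htne⟩
    obtain ⟨u₀, x₀, hu₀, hx₀⟩ := exists_unimodular_zero ha b hRE0 ⟨c, hc0, hc1, hc⟩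
    have hu₀0 : u₀ ≠ 0 := norm_pos_iff.1 (by rw [hu₀]; exact one_pos)
    exact unprojectedDense_lineSurface_of_tilted_edge b ha hirr μ κ hμ hκ hu₀
      (exists_curveFn_ne_zero ha b hRE0 hu₀0) hx₀

/-- **Mantova–Masser's question over a line of real irrational slope, every fibre polynomial:
case ∧ dense.**  `a ∈ ℝ ∖ ℚ`, `P` irreducible with torus fibres over infinitely many base points.
[cite: MantovaMasser2023, §1 Further remarks, p. 5 (the question, open in general)] (new) -/
theorem unprojectedDensityQuestion_lineSurface_of_irrational_all (ha : Irrational a)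
    (hirr : Irreducible P)
    (hfib : Set.Infinite {t : ℂ | ∃ c : Fin 2 → ℂ, c 0 ≠ 0 ∧ c 1 ≠ 0 ∧
      MvPolynomial.eval ![t, c 0, c 1] P = 0}) :
    MMCaseDimPiOneFree {w : Fin 2 ⊕ Fin 2 → ℂ | w (Sum.inl 1) = (linePoly a b).eval (w (Sum.inl 0)) ∧
        MvPolynomial.eval ![w (Sum.inl 0), w (Sum.inr 0), w (Sum.inr 1)] P = 0} ∧
      UnprojectedDense {w : Fin 2 ⊕ Fin 2 → ℂ | w (Sum.inl 1) = (linePoly a b).eval (w (Sum.inl 0)) ∧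
        MvPolynomial.eval ![w (Sum.inl 0), w (Sum.inr 0), w (Sum.inr 1)] P = 0} :=
  ⟨mmCase_lineSurface_of_irrational b P ha hirr hfib,
    unprojectedDense_lineSurface_of_irrational_all b ha hirr
      (exists_tail_ne_of_infinite_torusFibres hirr.ne_zero hfib)⟩

/-- **Example with a MONOMIAL top row**: `{x₁ = √2·x₀, y₁ = x₀y₀}` (`e^{√2z} = ze^z`) — not
covered by `unprojectedDense_lineSurface_of_irrational` — is in the case and dense. (new) -/
theorem unprojectedDensityQuestion_instance_sqrtTwoLine_y1_eq_x0y0 :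
    MMCaseDimPiOneFree {w : Fin 2 ⊕ Fin 2 → ℂ |
        w (Sum.inl 1) = (linePoly (Real.sqrt 2 : ℝ) 0).eval (w (Sum.inl 0)) ∧
        MvPolynomial.eval ![w (Sum.inl 0), w (Sum.inr 0), w (Sum.inr 1)]
          (X 2 - X 0 * X 1 : MvPolynomial (Fin 3) ℂ) = 0} ∧
      UnprojectedDense {w : Fin 2 ⊕ Fin 2 → ℂ |
        w (Sum.inl 1) = (linePoly (Real.sqrt 2 : ℝ) 0).eval (w (Sum.inl 0)) ∧
        MvPolynomial.eval ![w (Sum.inl 0), w (Sum.inr 0), w (Sum.inr 1)]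
          (X 2 - X 0 * X 1 : MvPolynomial (Fin 3) ℂ) = 0} :=
  unprojectedDensityQuestion_lineSurface_of_irrational_all 0 irrational_sqrt_two irreducible_PA
    PA_torusFibres_infinite

end All

end Summit.Schanuel.Schanuel.Theorems
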